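import Literature.Geometry.Lorentzian.SchwarzschildStaticLeaf
import Literature.Geometry.Lorentzian.ModelData
import HarnessLib

/-!
# The isotropic radial map of Schwarzschild and the conformally flat form of the static slice

Support file (all results proved; the definitions are explicit closed-form expressions, no
named facts), continuing `SchwarzschildStaticLeaf.lean`; part 1 of 2 of the proof that the
time-symmetric Schwarzschild exterior data (`Schwarzschild.timeSymmetricExteriorData`,
`ModelData.lean`) are an exact Kerr leaf (`SchwarzschildIsotropicLeaf.lean`).

* `Kerr.contDiffAt_staticLeafRep`, `Kerr.bilin_secondFundamentalFormRep_eq_zero` — two more facts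
  on the static leaf `Φ(x) = (2M log(r − 2M), x)` of the ingoing Kerr–Schild chart: smoothness of
  the representative, and the **representative form of the time symmetry** (the coordinate
  expression `g(DN V + Γ(N)(DΦ V), DΦ W)` of the second fundamental form vanishes for ALL ambient
  directions `V, W`, so that reparametrised static leaves are totally geodesic too);
* `Schwarzschild.isoMap M z = (1 + M/2ρ)² z` (`ρ = ‖z‖`) — the isotropic radial map, areal radius
  `r = ‖isoMap z‖ = ρ(1 + M/2ρ)²` (MTW 1973, (31.22)), with `r − 2M = ρ(ψ − 2)²`
  (`norm_isoMap_sub`), `2M < r` on the isotropic exterior `ρ > M/2` (`two_mul_lt_norm_isoMap`),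
  injectivity there (`isoMap_injOn`: `ρ ↦ ρ + M + M²/4ρ` increases on `ρ > M/2`), the differential
  `isoDeriv M z v = ψ²v − (ψM⟪z,v⟫/ρ³) z` (`hasFDerivAt_isoMap`) and smoothness off the origin;
* **`staticHRep_isoDeriv`** — the static-slice metric `(1 − 2M/r)⁻¹dr² + r²dΩ²`
  (`Kerr.staticHRep = δ + (2M/(r²(r − 2M))) x ⊗ x`) pulls back along the isotropic map to the
  conformally flat metric: `staticHRep_{isoMap z}(D isoMap v, D isoMap w) = (1 + M/2ρ)⁴ ⟪v, w⟫`.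

References: Misner–Thorne–Wheeler 1973, (31.22) (isotropic Schwarzschild); Wald 1984, §6.1, §6.4,
§10.2; Bray, J. Differential Geom. 59 (2001), §1 (the exterior region `{ρ > M/2}`).
-/

noncomputable section

-- instance search through the nested operator types `E4 →L E4 →L E4 →L ℝ` (as in `ChartCurvature`)
set_option maxSynthPendingDepth 3

open Bundle TopologicalSpace Manifold Set Module
open scoped ContDiff Topology InnerProductSpace

namespace Literature.Geometry.Lorentzian

namespace Kerr

/-! ### Two more facts on the static leaf representative -/

/-- The representative `Φ(x) = (T(‖x‖), x)` of the static leaf is `C^∞` at the points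
`‖x‖ > max (2M) 0`. [cite: Wald1984, §6.4] -/
theorem contDiffAt_staticLeafRep (M : ℝ) {x : E3} (hx : 2 * M < ‖x‖) (hx0 : x ≠ 0)
    {n : WithTop ℕ∞} : ContDiffAt ℝ n (staticLeafRep M) x := by
  have h : staticLeafRep M = fun x ↦ staticHeightFun M x • E4.basisVector 0 + E4.spaceEmbed x := by
    funext x
    rw [staticLeafRep, E4.ofTimeSpace_eq_smul_add']
  rw [h]
  exact ((contDiffAt_staticHeightFun M hx hx0).smul contDiffAt_const).add
    E4.spaceEmbed.contDiff.contDiffAt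

/-- **Time symmetry, representative form.** At a point `x` with `‖x‖ > max (2M) 0` and for ALL
ambient directions `V, W ∈ E3` (not only the differentials of a particular parametrisation),
`g_{Φ x}(DN(x) V + Γ_{Φ x}(N x)(DΦ(x) V), DΦ(x) W) = 0` — the coordinate expression of the second
fundamental form of the static leaf (`OpensChart.secondFundamentalForm_eq_of_repr`) vanishes; `pt` is
any point of a Kerr–Schild chart domain over `Φ x` (the Christoffel symbols only see its
coordinates). Used for reparametrised static leaves (the isotropic leaf below). Wald 1984, §10.2.
[cite: Wald1984, §10.2] -/
theorem bilin_secondFundamentalFormRep_eq_zero [Facts] {M r₀ : ℝ} (pt : region 0 r₀) {x : E3}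
    (hpt : (pt : E4) = staticLeafRep M x) (hx : 2 * M < ‖x‖) (hx0 : x ≠ 0) (V W : E3) :
    bilin M 0 (staticLeafRep M x) (fderiv ℝ (staticNormalRep M) x V +
      OpensChart.christoffel (smoothMetric M 0 r₀).toPseudoRiemannianMetric (bilin M 0) pt
        (staticNormalRep M x) (staticLeafDeriv M x V)) (staticLeafDeriv M x W) = 0 := by
  have hr : ‖x‖ ≠ 0 := norm_ne_zero_iff.2 hx0
  have hr2 : ‖x‖ - 2 * M ≠ 0 := (sub_pos.2 hx).ne'
  have hsp : E4.spatial (staticLeafRep M x) ≠ 0 := by rwa [spatial_staticLeafRep]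
  have hΓ := OpensChart.val_christoffel_const (g := (smoothMetric M 0 r₀).toPseudoRiemannianMetric)
    (G := bilin M 0) pt (staticNormalRep M x) (staticLeafDeriv M x V) (staticLeafDeriv M x W)
  have hΓ' : bilin M 0 (staticLeafRep M x) (OpensChart.christoffel
      (smoothMetric M 0 r₀).toPseudoRiemannianMetric (bilin M 0) pt
      (staticNormalRep M x) (staticLeafDeriv M x V)) (staticLeafDeriv M x W) =
      2⁻¹ * OpensChart.koszulForm (bilin M 0) (staticLeafRep M x) (staticNormalRep M x)
        (staticLeafDeriv M x V) (staticLeafDeriv M x W) := by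
    rw [← hpt]; exact hΓ
  rw [map_add, add_apply, hΓ', OpensChart.koszulForm_apply, fderiv_staticNormalRep M hx hx0 V,
    map_smul, smul_apply, bilin_basisVector_staticLeafDeriv M hx hx0 W, smul_zero,
    zero_add, fderiv_bilin_zero_apply M hsp, fderiv_bilin_zero_apply M hsp,
    fderiv_bilin_zero_apply M hsp]
  have h3 : ⟪W, V⟫_ℝ = ⟪V, W⟫_ℝ := real_inner_comm _ _
  simp only [bilinZeroDeriv_apply, nullCovectorZero_apply, nullCovectorZeroDeriv_apply,
    spatial_staticLeafRep, staticLeafDeriv_apply, E4.spatial_ofTimeSpace, E4.ofTimeSpace_apply_zero,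
    staticNormalRep, map_smul, smul_apply, smul_eq_mul,
    spatial_basisVector_zero, basisVector_zero_apply_zero, inner_zero_right, inner_zero_left]
  simp only [h3]
  ring

end Kerr

namespace Schwarzschild

/-! ### The isotropic radial map `z ↦ (1 + M/2|z|)² z` -/

/-- The derivative of the isotropic conformal factor `ψ = 1 + M/(2‖z‖)` away from the origin:
`dψ_z = −(M/2) ‖z‖⁻³ ⟪z, ·⟫`. MTW 1973, (31.22). [cite: MTW1973, (31.22)] -/
theorem hasFDerivAt_conformalFactor (M : ℝ) {z : E3} (hz : z ≠ 0) :
    HasFDerivAt (conformalFactor M) ((-(M / 2) / ‖z‖ ^ 3) • E3.covec z) z := by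
  have h := (Kerr.hasFDerivAt_const_div_norm_pow (M / 2) hz 1).const_add 1
  have hfun : conformalFactor M = fun y : E3 ↦ 1 + M / 2 / ‖y‖ ^ 1 := by
    funext y
    rw [conformalFactor, pow_one, div_div]
  rw [hfun]
  refine h.congr_fderiv ?_
  norm_num

/-- **The isotropic radial map** `z ↦ (1 + M/(2‖z‖))² z`: the areal (Kerr–Schild) position of the
isotropic point `z`, `‖(1 + M/2ρ)² z‖ = ρ (1 + M/2ρ)² = r` (`ρ = ‖z‖`), i.e. the classical change
of radius `r = ρ(1 + M/2ρ)²` between Schwarzschild and isotropic coordinates, extended radially.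
MTW 1973, (31.22); Wald 1984, §6.1. [cite: MTW1973, (31.22)] -/
def isoMap (M : ℝ) (z : E3) : E3 :=
  conformalFactor M z ^ 2 • z

/-- `‖isoMap z‖ = ψ(z)² ‖z‖` (`r = ρ (1 + M/2ρ)²`). [cite: MTW1973, (31.22)] -/
theorem norm_isoMap (M : ℝ) (z : E3) : ‖isoMap M z‖ = conformalFactor M z ^ 2 * ‖z‖ := by
  rw [isoMap, norm_smul, Real.norm_of_nonneg (sq_nonneg _)]

/-- The relation `M = 2ρ(ψ − 1)` between the mass and the conformal factor at `z ≠ 0`.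
[cite: MTW1973, (31.22)] -/
theorem mass_eq_of_conformalFactor (M : ℝ) {z : E3} (hz : z ≠ 0) :
    M = 2 * ‖z‖ * (conformalFactor M z - 1) := by
  have hr : ‖z‖ ≠ 0 := norm_ne_zero_iff.2 hz
  rw [conformalFactor]
  field_simp
  ring

/-- `r − 2M = ρ (ψ − 2)²` (`= ρ(1 − M/2ρ)²`): the areal radius of the isotropic point `z` exceeds
`2M` exactly by `ρ(1 − M/2ρ)²`. [cite: MTW1973, (31.22)] -/
theorem norm_isoMap_sub (M : ℝ) {z : E3} (hz : z ≠ 0) :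
    ‖isoMap M z‖ - 2 * M = ‖z‖ * (conformalFactor M z - 2) ^ 2 := by
  have hr : ‖z‖ ≠ 0 := norm_ne_zero_iff.2 hz
  rw [norm_isoMap, conformalFactor]
  field_simp
  ring

/-- On the isotropic exterior `‖z‖ > M/2`, `ψ ≠ 2` (`ψ − 2 = (M/2 − ρ)/ρ < 0`). [cite: Bray2001, §1] -/
theorem conformalFactor_sub_two_neg (M : ℝ) {z : E3} (hz : M / 2 < ‖z‖) (hz0 : z ≠ 0) :
    conformalFactor M z - 2 < 0 := by
  have hr : 0 < ‖z‖ := norm_pos_iff.2 hz0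
  rw [conformalFactor]
  have : M / (2 * ‖z‖) < 1 := by
    rw [div_lt_one (by positivity)]
    linarith
  linarith

/-- **On the isotropic exterior the areal radius exceeds `2M`**: `2M < ‖isoMap z‖` for `z ≠ 0`,
`‖z‖ > M/2`. [cite: MTW1973, (31.22)] -/
theorem two_mul_lt_norm_isoMap (M : ℝ) {z : E3} (hz : M / 2 < ‖z‖) (hz0 : z ≠ 0) :
    2 * M < ‖isoMap M z‖ := by
  have h := norm_isoMap_sub M hz0
  have hr : 0 < ‖z‖ := norm_pos_iff.2 hz0
  have hne : conformalFactor M z - 2 ≠ 0 := (conformalFactor_sub_two_neg M hz hz0).ne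
  have hq : 0 < ‖z‖ * (conformalFactor M z - 2) ^ 2 := by positivity
  linarith

/-- For `0 ≤ M` the isotropic map does not hit the origin off the origin (`ψ ≥ 1`).
[cite: MTW1973, (31.22)] -/
theorem isoMap_ne_zero {M : ℝ} (hM : 0 ≤ M) {z : E3} (hz0 : z ≠ 0) : isoMap M z ≠ 0 := by
  rw [← norm_pos_iff, norm_isoMap]
  exact mul_pos (pow_pos (conformalFactor_pos hM z) 2) (norm_pos_iff.2 hz0)

/-- **The isotropic map is injective on the isotropic exterior** (`M ≥ 0`): the radial profile
`ρ ↦ ρ(1 + M/2ρ)² = ρ + M + M²/4ρ` is strictly increasing on `ρ > M/2`. [cite: MTW1973, (31.22)] -/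
theorem isoMap_injOn {M : ℝ} (hM : 0 ≤ M) :
    Set.InjOn (isoMap M) {z : E3 | M / 2 < ‖z‖} := by
  -- the radial profile and its strict monotonicity
  have hprof : ∀ z : E3, z ≠ 0 → ‖isoMap M z‖ = ‖z‖ + M + M ^ 2 / (4 * ‖z‖) := by
    intro z hz
    have hr : ‖z‖ ≠ 0 := norm_ne_zero_iff.2 hz
    rw [norm_isoMap, conformalFactor]
    field_simp
    ring
  have hmono : ∀ s t : ℝ, M / 2 < s → s < t → s + M + M ^ 2 / (4 * s) < t + M + M ^ 2 / (4 * t) := by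
    intro s t hs hst
    have hs0 : 0 < s := by linarith
    have ht0 : 0 < t := by linarith
    have key : t + M + M ^ 2 / (4 * t) - (s + M + M ^ 2 / (4 * s)) =
        (t - s) * (1 - M ^ 2 / (4 * (s * t))) := by
      field_simp
      ring
    have h1 : M ^ 2 / (4 * (s * t)) < 1 := by
      rw [div_lt_one (by positivity)]
      have : M / 2 * (M / 2) < s * t := by
        have hM2 : 0 ≤ M / 2 := by linarith
        calc M / 2 * (M / 2) ≤ s * (M / 2) := by nlinarith
          _ < s * t := by nlinarith
      nlinarith
    nlinarith
  intro z hz z' hz' h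
  simp only [Set.mem_setOf_eq] at hz hz'
  have hz0 : z ≠ 0 := fun h0 ↦ by rw [h0, norm_zero] at hz; linarith
  have hz0' : z' ≠ 0 := fun h0 ↦ by rw [h0, norm_zero] at hz'; linarith
  -- equal norms
  have hn : ‖z‖ = ‖z'‖ := by
    have he : ‖isoMap M z‖ = ‖isoMap M z'‖ := by rw [h]
    rw [hprof z hz0, hprof z' hz0'] at he
    rcases lt_trichotomy ‖z‖ ‖z'‖ with hlt | heq | hgt
    · exact absurd he (hmono _ _ hz hlt).ne
    · exact heq
    · exact absurd he (hmono _ _ hz' hgt).ne'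
  -- equal conformal factors, hence equal points
  have hc : conformalFactor M z = conformalFactor M z' := by rw [conformalFactor, conformalFactor, hn]
  have hp : conformalFactor M z ^ 2 ≠ 0 := pow_ne_zero 2 (conformalFactor_pos hM z).ne'
  have h' : conformalFactor M z ^ 2 • z = conformalFactor M z ^ 2 • z' := by
    have := h
    rw [isoMap, isoMap, ← hc] at this
    exact this
  exact smul_right_injective E3 hp h'

/-- The conformal factor is `C^∞` off the origin (pointwise form of
`contDiffOn_conformalFactor`). [cite: MTW1973, (31.22)] -/
theorem contDiffAt_conformalFactor (M : ℝ) {z : E3} (hz : z ≠ 0) {n : WithTop ℕ∞} :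
    ContDiffAt ℝ n (conformalFactor M) z := by
  have h : ContDiffAt ℝ n (fun y : E3 ↦ ‖y‖) z := contDiffAt_norm ℝ hz
  have h2 : (2 : ℝ) * ‖z‖ ≠ 0 := mul_ne_zero two_ne_zero (norm_ne_zero_iff.mpr hz)
  exact contDiffAt_const.add (contDiffAt_const.div (contDiffAt_const.mul h) h2)

/-- **The differential of the isotropic map**, as a continuous linear map:
`v ↦ ψ² v − (ψ M ⟪z, v⟫/ρ³) z`. [cite: MTW1973, (31.22)] -/
def isoDeriv (M : ℝ) (z : E3) : E3 →L[ℝ] E3 :=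
  conformalFactor M z ^ 2 • ContinuousLinearMap.id ℝ E3 -
    (conformalFactor M z * M / ‖z‖ ^ 3) • (E3.covec z).smulRight z

/-- `isoDeriv M z v = ψ² v − (ψ M ⟪z, v⟫ / ρ³) z`. [cite: MTW1973, (31.22)] -/
theorem isoDeriv_apply (M : ℝ) (z v : E3) :
    isoDeriv M z v = conformalFactor M z ^ 2 • v -
      (conformalFactor M z * M / ‖z‖ ^ 3 * ⟪z, v⟫_ℝ) • z := by
  simp only [isoDeriv, sub_apply, smul_apply, ContinuousLinearMap.id_apply,
    ContinuousLinearMap.smulRight_apply, E3.covec_apply, smul_smul]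

/-- The isotropic map is differentiable off the origin, with derivative `isoDeriv`.
[cite: MTW1973, (31.22)] -/
theorem hasFDerivAt_isoMap (M : ℝ) {z : E3} (hz : z ≠ 0) :
    HasFDerivAt (isoMap M) (isoDeriv M z) z := by
  have h : HasFDerivAt (isoMap M) _ z :=
    ((hasFDerivAt_conformalFactor M hz).pow 2).smul (hasFDerivAt_id (𝕜 := ℝ) z)
  refine h.congr_fderiv (ContinuousLinearMap.ext fun v ↦ ?_)
  simp only [isoDeriv_apply, add_apply, smul_apply, ContinuousLinearMap.id_apply,
    ContinuousLinearMap.smulRight_apply, E3.covec_apply, smul_smul, smul_eq_mul,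
    nsmul_eq_mul, Nat.cast_ofNat, pow_one, Nat.add_one_sub_one, sub_eq_add_neg, ← neg_smul]
  congr 1
  congr 1
  ring

/-- The isotropic map is `C^∞` off the origin. [cite: MTW1973, (31.22)] -/
theorem contDiffAt_isoMap (M : ℝ) {z : E3} (hz : z ≠ 0) {n : WithTop ℕ∞} :
    ContDiffAt ℝ n (isoMap M) z :=
  ((contDiffAt_conformalFactor M hz).pow 2).smul contDiffAt_id

/-- `⟪isoMap z, isoDeriv z v⟫ = (ψ⁴ − ψ³ M/ρ) ⟪z, v⟫` (`= ψ³(1 − M/2ρ)⟪z, v⟫`). [cite: MTW1973, (31.22)] -/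
theorem inner_isoMap_isoDeriv (M : ℝ) {z : E3} (hz : z ≠ 0) (v : E3) :
    ⟪isoMap M z, isoDeriv M z v⟫_ℝ =
      (conformalFactor M z ^ 4 - conformalFactor M z ^ 3 * M / ‖z‖) * ⟪z, v⟫_ℝ := by
  have hr : ‖z‖ ≠ 0 := norm_ne_zero_iff.2 hz
  simp only [isoMap, isoDeriv_apply, inner_smul_left, inner_sub_right, inner_smul_right,
    real_inner_self_eq_norm_sq, conj_trivial]
  field_simp

/-- `⟪isoDeriv z v, isoDeriv z w⟫ = ψ⁴ ⟪v, w⟫ − (2ψ³M/ρ³ − ψ²M²/ρ⁴) ⟪z, v⟫⟪z, w⟫`.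
[cite: MTW1973, (31.22)] -/
theorem inner_isoDeriv_isoDeriv (M : ℝ) {z : E3} (hz : z ≠ 0) (v w : E3) :
    ⟪isoDeriv M z v, isoDeriv M z w⟫_ℝ =
      conformalFactor M z ^ 4 * ⟪v, w⟫_ℝ -
        (2 * conformalFactor M z ^ 3 * M / ‖z‖ ^ 3 - conformalFactor M z ^ 2 * M ^ 2 / ‖z‖ ^ 4) *
          (⟪z, v⟫_ℝ * ⟪z, w⟫_ℝ) := by
  have hr : ‖z‖ ≠ 0 := norm_ne_zero_iff.2 hz
  simp only [isoDeriv_apply, inner_sub_left, inner_sub_right, inner_smul_left, inner_smul_right,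
    real_inner_self_eq_norm_sq, conj_trivial, real_inner_comm z v]
  field_simp
  ring

/-- The radial coefficient `2M/(r²(r − 2M))` of the static-slice metric at the isotropic point
`z`, in isotropic terms: `2M/(ψ⁴ρ³(ψ − 2)²)` (`r = ψ²ρ`, `r − 2M = ρ(ψ − 2)²`). [cite: MTW1973, (31.22)] -/
theorem staticCoeff_isoMap (M : ℝ) {z : E3} (hz0 : z ≠ 0) :
    2 * M / (‖isoMap M z‖ ^ 2 * (‖isoMap M z‖ - 2 * M)) =
      2 * M / (conformalFactor M z ^ 4 * ‖z‖ ^ 3 * (conformalFactor M z - 2) ^ 2) := by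
  rw [norm_isoMap_sub M hz0, norm_isoMap]
  congr 1
  ring

/-- **The isotropic form of the Schwarzschild slice metric.** Pulling the static-slice metric
`δ + (2M/(r²(r − 2M))) x ⊗ x` (`Kerr.staticHRep`, `= (1 − 2M/r)⁻¹dr² + r²dΩ²`) back along the
isotropic map gives the conformally flat metric `(1 + M/2ρ)⁴ δ`:
`staticHRep_{isoMap z}(D isoMap v, D isoMap w) = ψ(z)⁴ ⟪v, w⟫` on `‖z‖ > M/2`, `0 ≤ M` (with
`M = 2ρ(ψ − 1)` both sides are rational in `ψ`, `ρ`; the areal factor `r − 2M = ρ(ψ − 2)²`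
cancels). MTW 1973, (31.22); Wald 1984, §6.1. [cite: MTW1973, (31.22)] -/
theorem staticHRep_isoDeriv {M : ℝ} (hM : 0 ≤ M) {z : E3} (hz : M / 2 < ‖z‖) (hz0 : z ≠ 0)
    (v w : E3) :
    Kerr.staticHRep M (isoMap M z) (isoDeriv M z v) (isoDeriv M z w) =
      conformalFactor M z ^ 4 * ⟪v, w⟫_ℝ := by
  have hr : ‖z‖ ≠ 0 := norm_ne_zero_iff.2 hz0
  have hp0 : conformalFactor M z ≠ 0 := (conformalFactor_pos hM z).ne'
  have hp2 : conformalFactor M z - 2 ≠ 0 := (conformalFactor_sub_two_neg M hz hz0).ne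
  have hrel := mass_eq_of_conformalFactor M hz0
  rw [Kerr.staticHRep_apply, staticCoeff_isoMap M hz0, inner_isoMap_isoDeriv M hz0,
    inner_isoMap_isoDeriv M hz0, inner_isoDeriv_isoDeriv M hz0]
  generalize hp : conformalFactor M z = p at hrel hp0 hp2 ⊢
  subst hrel
  field_simp
  ring

end Schwarzschild

end Literature.Geometry.Lorentzian

end
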